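import Summits.ValiantsHypothesis.ValiantsHypothesis.Theses.IntegralOrbits
import Summits.ValiantsHypothesis.ValiantsHypothesis.Theorems.IntegralOrbitsHeightToSize
import Summits.ValiantsHypothesis.ValiantsHypothesis.Theorems.IntegralOrbitsIntDetQPShortWordBasis
import Summits.ValiantsHypothesis.ValiantsHypothesis.Theorems.IntegralOrbitsIntDetQPRegularPencilDet
import Summits.ValiantsHypothesis.ValiantsHypothesis.Theorems.IntegralOrbitsIntDetQPTraceCramer
import Summits.ValiantsHypothesis.ValiantsHypothesis.Theorems.IntegralOrbitsIntDetQPAdjugateEntryBound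
import Summits.ValiantsHypothesis.ValiantsHypothesis.Theorems.IntegralOrbitsIntDetQPLiftAssembly
import Summits.ValiantsHypothesis.ValiantsHypothesis.Theorems.IntegralOrbitsIntDetQPGlueFreeDenominator

/-!
# `IntDetQP` reduced to `RationalCharacterNF` (crux stmt-ValiantsHypothesis-7677, line `birth`)

Two sorry-free consequences of the six landed stub files of the line:

* `liftFreeDenominator` — the FREE-DENOMINATOR INTEGRAL LIFT, unconditionally: an absolutely
  irreducible tuple `M : ι → M_m(ℂ)` (words span `M_m(ℂ)`) whose character `w ↦ tr M_w` is
  `ℤ[1/N]`-valued with `|numerator| ≤ 2^(h(|w|+1))`, exponents `≤ h(|w|+1)`, `1 ≤ N ≤ 2^h`, admits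
  integer matrices `Z_v` of size `m²`, a denominator `1 ≤ D ≤ 2^((m+#ι+h+2)^c)` and entries
  `≤ 2^((m+#ι+h+2)^c)` with `det (X₀·1 + Σ_v X_v Z_v/D) = det (X₀·1 + Σ_v X_v M_v)^r`, `r ≥ 1`
  (word basis of length `≤ m²`, trace-form Gram system solved by Cramer, `D = |det G̃|`,
  `Z_v = ± adj G̃ · T̃_v`, left-regular representation for the determinant). This is the route's
  `IntegralCharacterLift` (stmt-7679) with the denominator freed from being a power of `N` — which
  is all the glue needs, since `IntDetQP` allows any nonzero integer multiplier.
* `intDetQP_of_rationalCharacterNF` — the crux `IntegralOrbits.IntDetQP` follows from the single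
  route item `RationalCharacterNF` (stmt-ValiantsHypothesis-7678, the Diophantine core), by the lift
  above, the free-denominator glue `stub_glueFreeDenominator` and the landed `heightToSize_proof`.

No new definitions; pure composition of landed theorems.
-/

set_option linter.dupNamespace false -- single-conjunct summit: `ValiantsHypothesis.ValiantsHypothesis`

namespace Summit.ValiantsHypothesis.ValiantsHypothesis.Theorems

open scoped BigOperators

/-- **Free-denominator integral lift** (unconditional). An absolutely irreducible matrix tuple
`M : ι → M_m(ℂ)` with `ℤ[1/N]`-valued character of height `h` (numerators `≤ 2^(h(ℓ+1))`,
`N`-exponents `≤ h(ℓ+1)` on words of length `ℓ`, `1 ≤ N ≤ 2^h`) admits an integral model of size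
`m²`: integer matrices `Z_v`, a denominator `1 ≤ D ≤ 2^((m+#ι+h+2)^c)`, entries bounded by the
same, and `det (X₀·1 + Σ_v X_v Z_v / D) = det (X₀·1 + Σ_v X_v M_v)^r` with `r ≥ 1`. Composition of
the landed stubs `stub_liftAssembly`, `stub_shortWordBasis`, `stub_regularPencilDet`,
`stub_traceCramer`, `stub_adjugateEntryBound` of line `birth` of crux stmt-ValiantsHypothesis-7677.
[folklore] -/
theorem liftFreeDenominator :
    ∃ c : ℕ, ∀ (ι : Type) [Fintype ι] [DecidableEq ι] (m N h : ℕ) (M : ι → Matrix (Fin m) (Fin m) ℂ),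
      1 ≤ N → N ≤ 2 ^ h →
      Submodule.span ℂ (Set.range fun w : List ι => (w.map M).prod) = ⊤ →
      (∀ w : List ι, ∃ (z : ℤ) (e : ℕ), ((w.map M).prod).trace = (z : ℂ) / (N : ℂ) ^ e ∧
          |z| ≤ 2 ^ (h * (w.length + 1)) ∧ e ≤ h * (w.length + 1)) →
      ∃ (D r : ℕ) (Z : ι → Matrix (Fin m × Fin m) (Fin m × Fin m) ℤ),
        1 ≤ r ∧ 1 ≤ D ∧ D ≤ 2 ^ ((m + Fintype.card ι + h + 2) ^ c) ∧
        (∀ v a b, |Z v a b| ≤ 2 ^ ((m + Fintype.card ι + h + 2) ^ c)) ∧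
        ((MvPolynomial.X none : MvPolynomial (Option ι) ℂ) •
              (1 : Matrix (Fin m × Fin m) (Fin m × Fin m) (MvPolynomial (Option ι) ℂ)) +
            ∑ v : ι, (MvPolynomial.X (some v) : MvPolynomial (Option ι) ℂ) •
              (Z v).map (fun z : ℤ => (MvPolynomial.C ((z : ℂ) / (D : ℂ)) : MvPolynomial (Option ι) ℂ))).det =
          (((MvPolynomial.X none : MvPolynomial (Option ι) ℂ) •
                (1 : Matrix (Fin m) (Fin m) (MvPolynomial (Option ι) ℂ)) +
              ∑ v : ι, (MvPolynomial.X (some v) : MvPolynomial (Option ι) ℂ) •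
                (M v).map (MvPolynomial.C : ℂ →+* MvPolynomial (Option ι) ℂ)).det) ^ r :=
  stub_liftAssembly stub_shortWordBasis stub_regularPencilDet stub_traceCramer stub_adjugateEntryBound

/-- **The crux `IntDetQP` reduced to the Diophantine core.** The route item `RationalCharacterNF`
(stmt-ValiantsHypothesis-7678: rational, `ℤ[1/N]`-integral, small-height character normal form of a
small complex determinantal expression of `per_n`) implies `IntegralOrbits.IntDetQP`
(stmt-ValiantsHypothesis-7677: `VP ℂ = VNP ℂ ⇒` quasi-polynomial sign-determinant expressions of
some `N·per_n^d`), by the free-denominator lift `liftFreeDenominator`, the free-denominator glue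
`stub_glueFreeDenominator` and the landed height compression `heightToSize_proof`. [folklore] -/
theorem intDetQP_of_rationalCharacterNF :
    Summit.ValiantsHypothesis.ValiantsHypothesis.Theses.IntegralOrbits.RationalCharacterNF →
      Summit.ValiantsHypothesis.ValiantsHypothesis.Theses.IntegralOrbits.IntDetQP :=
  fun hNF => stub_glueFreeDenominator hNF liftFreeDenominator heightToSize_proof

end Summit.ValiantsHypothesis.ValiantsHypothesis.Theorems
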